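import Summits.QuantumFields.YangMills.Theorems.LuscherReductionTwistedTraceScalingFPWeightChart
import Summits.QuantumFields.YangMills.Theorems.LuscherReductionTwistedTraceScalingSliceCoerciveBased
import Summits.QuantumFields.YangMills.Theorems.LuscherReductionTwistedTraceScalingLaplaceSandwich
import Summits.QuantumFields.YangMills.Theorems.LuscherReductionTwistedTraceScalingSlicePointFat
import HarnessLib

/-!
# (N2) part 1 — the chart integrand of the Faddeev–Popov weight at a tube point: definitions, measurability, the based average in the vacuum gnomonic chart
# (lane A of S-BASE, crux `TwistedTraceScaling` stmt-QuantumFields-20203, C4 INNER; design note `pub/ym-fleet/ym-luscher-20007-p1/COARSE-DESIGN.md` §23.9 (N2))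

Definitions and bookkeeping for the Laplace evaluation (N2) of the Faddeev–Popov weight (`…FPWeightLaplace`): the tube point `tubePt p = orthoTube P(c) w` of a
base point `p = (w, c)`; the Laplace linear map in flat based coordinates `laplaceMap p = P_Γ ∘ basedLin p ∘ flatLin`; the based integrand `fpBased` and the chart integrand
`fpIntegrand p w = recordWeightRho(U^{basedExt(gno∘w)})` with ★ `fpIntegrand_eq` (`= 𝟙·exp(−‖P_Γ fB(gnoParam w, p)‖²/s²)`), measurability, `0 ≤ · ≤ 1`; ★★ `gaugeAvg_eq_integral_fpIntegrand`:
`N(U) = ∫ piGnDensity(w)·fpIntegrand p w dw` when `U ∈ nearOne ρ₁` and `3(L−1)(ρ₁ + ρ β) < 2` (other hemisphere patterns do not meet the fat tube, `…BasedNearOne`); the exponent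
sandwich `sq_norm_add_sandwich`.
HONEST FRAMING: analysis for a stub of a child of the CONDITIONAL reduction route R2b1 (the Faddeev–Popov normalisation of the tube of record); no spectral claim; C4 OPEN; not a gap,
not Clay.
-/

set_option autoImplicit false

noncomputable section

open MeasureTheory Real
open scoped BigOperators
open Literature.MathematicalPhysics.QuantumFieldTheory
open Literature.MathematicalPhysics.QuantumLattice

namespace Summit.QuantumFields.YangMills.Theorems.FemtoTransferGap.TwoLattice.ConstTube

open Summit.QuantumFields.YangMills.Theorems.FemtoTransferGap
open Summit.QuantumFields.YangMills.Theorems.FemtoTransferGap.TwoLattice.Avg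
open Summit.QuantumFields.YangMills.Theorems.FemtoTransferGap.TwoLattice.Stiff (LinkSpace)
open Summit.QuantumFields.YangMills.Theorems.FemtoTransferGap.TwoLattice.GnChart
open Literature.MathematicalPhysics.QuantumFieldTheory.Balaban1983to89.T4CubeChartGnomonic (gnoPoint)

variable (L : ℕ) [NeZero L]

/-! ## §1 Elementary pieces -/

omit [NeZero L] in
/-- Exponent sandwich: `‖R‖ ≤ θ‖a‖`, `0 ≤ θ ≤ 1` ⇒ `(1−2θ)‖a‖² ≤ ‖a+R‖² ≤ (1+3θ)‖a‖²`. [folklore] -/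
theorem sq_norm_add_sandwich {F : Type*} [NormedAddCommGroup F] {a R : F} {θ : ℝ} (hθ1 : θ ≤ 1) (hR : ‖R‖ ≤ θ * ‖a‖) :
    (1 - 2 * θ) * ‖a‖ ^ 2 ≤ ‖a + R‖ ^ 2 ∧ ‖a + R‖ ^ 2 ≤ (1 + 3 * θ) * ‖a‖ ^ 2 := by
  have ha : 0 ≤ ‖a‖ := norm_nonneg a
  have hθ0 : 0 ≤ θ * ‖a‖ := (norm_nonneg R).trans hR
  have hup : ‖a + R‖ ≤ (1 + θ) * ‖a‖ := by
    calc ‖a + R‖ ≤ ‖a‖ + ‖R‖ := norm_add_le _ _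
      _ ≤ ‖a‖ + θ * ‖a‖ := by linarith
      _ = (1 + θ) * ‖a‖ := by ring
  have hlo : (1 - θ) * ‖a‖ ≤ ‖a + R‖ := by
    have h := norm_sub_norm_le a (a + R)
    rw [show a - (a + R) = -R by abel, norm_neg] at h
    nlinarith
  have hlo0 : 0 ≤ (1 - θ) * ‖a‖ := by nlinarith
  constructor
  · nlinarith [mul_self_le_mul_self hlo0 hlo]
  · nlinarith [mul_self_le_mul_self (norm_nonneg _) hup]

omit [NeZero L] in
/-- A unit quaternion within Frobenius distance `< 2` of `1` has positive scalar part. [folklore] -/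
theorem scalarPart_pos_of_frobNorm_lt_two {V : SU2} (h : frobNorm ((V : Matrix (Fin 2) (Fin 2) ℂ) - 1) < 2) : 0 < scalarPart V := by
  have h2 := frobNorm_sub_one_sq_eq_scalarPart V
  have h0 := frobNorm_nonneg ((V : Matrix (Fin 2) (Fin 2) ℂ) - 1)
  nlinarith

/-- The tube point of a base point. [folklore] -/
def tubePt (p : balancedSubmodule L × (Fin 3 → Fin 3 → ℝ)) : GaugeConfig 3 L SU2 :=
  orthoTube L (fun e₁ => chartSU2 (p.2 e₁.2)) (p.1 : Edge 3 L → Fin 3 → ℝ)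

/-- A gauge transformation of the tube point in the `P`-chart is `actCfg`, and its relative coordinate is `fB`. [folklore] -/
theorem relLinkVec_gaugeTransform_tubePt (p : balancedSubmodule L × (Fin 3 → Fin 3 → ℝ)) (ξ : basedSubmodule L) :
    relLinkVec L (gaugeTransform (fun x => chartSU2 ((ξ : Site 3 L → Fin 3 → ℝ) x)) (tubePt L p)) = basedFn L (ξ, p) := rfl

/-- The Laplace linear map in flat based coordinates: `A = P_Γ ∘ basedLin p ∘ flatLin`. [folklore] -/
def laplaceMap (p : balancedSubmodule L × (Fin 3 → Fin 3 → ℝ)) : (NzSite L → Fin 3 → ℝ) →ₗ[ℝ] LinkSpace L :=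
  ((gaugeModes L).starProjection.toLinearMap ∘ₗ (basedLin L p).toLinearMap) ∘ₗ flatLin L

/-- Its action. [folklore] -/
theorem laplaceMap_apply (p : balancedSubmodule L × (Fin 3 → Fin 3 → ℝ)) (w : NzSite L → Fin 3 → ℝ) :
    laplaceMap L p w = (gaugeModes L).starProjection (basedLin L p (flatLin L w)) := rfl

/-- The based integrand `g(h) = recordWeightRho(U*^{basedExt h})`. [folklore] -/
def fpBased (δ ρ δg : ℝ → ℝ) (β : ℝ) (p : balancedSubmodule L × (Fin 3 → Fin 3 → ℝ)) (h : NzSite L → SU2) : ℝ :=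
  recordWeightRho L δ ρ δg β (gaugeTransform (basedExt L h) (tubePt L p))

/-- It is measurable. [folklore] -/
theorem measurable_fpBased (δ ρ δg : ℝ → ℝ) (β : ℝ) (p : balancedSubmodule L × (Fin 3 → Fin 3 → ℝ)) : Measurable (fpBased L δ ρ δg β p) := by
  have h1 : Measurable fun g : Site 3 L → SU2 => recordWeightRho L δ ρ δg β (gaugeTransform g (tubePt L p)) :=
    measurable_comp_gaugeTransform_left (measurable_recordWeightRho L δ ρ δg β) (tubePt L p)
  exact h1.comp (measurable_basedExt L)

/-- `0 ≤ g ≤ 1`. [folklore] -/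
theorem fpBased_mem_Icc (δ ρ δg : ℝ → ℝ) (β : ℝ) (p : balancedSubmodule L × (Fin 3 → Fin 3 → ℝ)) (h : NzSite L → SU2) :
    fpBased L δ ρ δg β p h ∈ Set.Icc (0 : ℝ) 1 := recordWeightRho_mem_Icc L δ ρ δg β _

/-- If `g(h) ≠ 0` the transformed tube point is in the fat tube. [folklore] -/
theorem mem_fatTubeRho_of_fpBased_ne_zero {δ ρ δg : ℝ → ℝ} {β : ℝ} {p : balancedSubmodule L × (Fin 3 → Fin 3 → ℝ)} {h : NzSite L → SU2}
    (hne : fpBased L δ ρ δg β p h ≠ 0) : gaugeTransform (basedExt L h) (tubePt L p) ∈ fatTubeRho L δ ρ β := by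
  by_contra hnot
  apply hne
  unfold fpBased recordWeightRho
  rw [Set.indicator_of_notMem hnot, zero_mul]

/-- The chart integrand `G(w) = g(gnoPoint ∘ w)`. [folklore] -/
def fpIntegrand (δ ρ δg : ℝ → ℝ) (β : ℝ) (p : balancedSubmodule L × (Fin 3 → Fin 3 → ℝ)) (w : NzSite L → Fin 3 → ℝ) : ℝ :=
  fpBased L δ ρ δg β p fun y => gnoPoint (w y)

/-- The chart integrand is a product `𝟙 · exp(−‖P_Γ fB(gnoParam w, p)‖²/s²)`. [folklore] -/
theorem fpIntegrand_eq (δ ρ δg : ℝ → ℝ) (β : ℝ) (p : balancedSubmodule L × (Fin 3 → Fin 3 → ℝ)) (w : NzSite L → Fin 3 → ℝ) :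
    fpIntegrand L δ ρ δg β p w =
      (fatTubeRho L δ ρ β).indicator (fun _ => (1 : ℝ)) (gaugeTransform (basedExt L fun y => gnoPoint (w y)) (tubePt L p)) *
        Real.exp (-(‖(gaugeModes L).starProjection (basedFn L (gnoParam L w, p))‖ ^ 2 / δg β ^ 2)) := by
  unfold fpIntegrand fpBased recordWeightRho gaugeCoordSq
  rw [basedExt_gno_eq, relLinkVec_gaugeTransform_tubePt]

omit [NeZero L] in
/-- The gnomonic lift `w ↦ gnoPoint ∘ w` is measurable. [folklore] -/
theorem measurable_gnoLift : Measurable fun w : NzSite L → Fin 3 → ℝ => (fun y => gnoPoint (w y)) :=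
  measurable_pi_lambda _ fun y => Balaban1983to89.T4CubeChartGnomonic.continuous_gnoPoint.measurable.comp (measurable_pi_apply y)

/-- `G` is measurable. [folklore] -/
theorem measurable_fpIntegrand (δ ρ δg : ℝ → ℝ) (β : ℝ) (p : balancedSubmodule L × (Fin 3 → Fin 3 → ℝ)) : Measurable (fpIntegrand L δ ρ δg β p) :=
  (measurable_fpBased L δ ρ δg β p).comp (measurable_gnoLift L)

/-- `0 ≤ G ≤ 1`. [folklore] -/
theorem fpIntegrand_mem_Icc (δ ρ δg : ℝ → ℝ) (β : ℝ) (p : balancedSubmodule L × (Fin 3 → Fin 3 → ℝ)) (w : NzSite L → Fin 3 → ℝ) :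
    fpIntegrand L δ ρ δg β p w ∈ Set.Icc (0 : ℝ) 1 := fpBased_mem_Icc L δ ρ δg β p _

/-- The based average IS the flat integral of `density · G` (vacuum gnomonic chart; other hemispheres do not meet the fat tube). [folklore] -/
theorem gaugeAvg_eq_integral_fpIntegrand {δ ρ δg : ℝ → ℝ} {β : ℝ} (p : balancedSubmodule L × (Fin 3 → Fin 3 → ℝ)) {ρ₁ : ℝ}
    (hU1 : tubePt L p ∈ nearOne L ρ₁) (hsmall : 3 * ((L : ℝ) - 1) * (ρ₁ + ρ β) < 2) :
    gaugeAvg (recordWeightRho L δ ρ δg β) (tubePt L p) = ∫ w, piGnDensityReal (NzSite L) w * fpIntegrand L δ ρ δg β p w := by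
  classical
  have hgb : ∃ C : ℝ, ∀ h, |fpBased L δ ρ δg β p h| ≤ C := ⟨1, fun h => by
    obtain ⟨h0, h1⟩ := fpBased_mem_Icc L δ ρ δg β p h
    rw [abs_of_nonneg h0]; exact h1⟩
  have hg0 : ∀ V : NzSite L → SU2, (∃ i, scalarPart (V i) ≤ 0) → fpBased L δ ρ δg β p V = 0 := by
    rintro V ⟨i, hi⟩
    by_contra hne
    have hmem := mem_fatTubeRho_of_fpBased_ne_zero L hne
    have hF := frobNorm_basedExt_sub_one_le L hU1 hmem.1 i.1
    rw [basedExt_of_ne L V i.2] at hF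
    exact absurd (scalarPart_pos_of_frobNorm_lt_two (lt_of_le_of_lt hF hsmall)) (not_lt.mpr hi)
  rw [gaugeAvg_recordWeightRho_eq_based]
  rw [show basedMeasure L = Measure.pi (fun _ : NzSite L => haarProbability SU2) from rfl]
  rw [show (fun h : NzSite L → SU2 => recordWeightRho L δ ρ δg β (gaugeTransform (basedExt L h) (tubePt L p))) = fpBased L δ ρ δg β p from rfl,
    integral_pi_haar_eq_vacuumChart (NzSite L) (measurable_fpBased L δ ρ δg β p) hgb hg0]
  refine integral_congr_ae (ae_of_all _ fun w => ?_)
  have hchart : piPatternChart (NzSite L) (fun _ => false) w = fun y => gnoPoint (w y) := funext (piPatternChart_false (NzSite L) w)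
  show piGnDensityReal (NzSite L) w * fpBased L δ ρ δg β p (piPatternChart (NzSite L) (fun _ => false) w) = _
  rw [hchart]
  rfl

end Summit.QuantumFields.YangMills.Theorems.FemtoTransferGap.TwoLattice.ConstTube

end
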